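import Summits.BirchSwinnertonDyer.Rank1Residual.X2.ClassClosureO9Certificate
import Literature.NumberTheory.EllipticCurves.PAdicLFunctionNonsplitRiemannSumCertificateProofs
import HarnessLib

/-!
# O9 (X2c), NON-SPLIT sub-cell: the per-pair Schneider certificate bit `[T¹]L_p(E,T) ≠ 0` in
# KERNEL form — a plus-symbol bound `C` and ONE Riemann sum of the signed Mazur–Tate–Teitelbaum
# measure beating the truncation bound (cell `b2b-bsdres`, lane CLASS-CLOSURE, seat `cc-typer-6`
# GEN 7, O9 typer of record; theorems only — no definition, no named fact, nothing booked)

HONEST FRAMING (run/shared/lean/b2b/bsd-rank1-residual/, verbatim in every file): the goal of the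
cell is to DELETE the COMBINATION-SHAPED residual classes of the Birch–Swinnerton-Dyer formula for
ALL analytic-rank `≤ 1` elliptic curves over `ℚ` — "full BSD formula for every rank `≤ 1` curve in
class `C`" assembled STRICTLY from published theorems — so that the rank-`≤ 1` remainder becomes
exactly the CONSTRUCTION-SHAPED classes, which are TYPED (missing-input `Prop`s), NOT attempted.
This is not "finishing BSD". Lane CLASS-CLOSURE (coordinator ruling 2026-08-21T04:07:19Z): research
routes; no claim beyond the stated classes; census / instrument output is EVIDENCE, never a
Literature fact; per-pair certificates are INSTRUMENTATION (E4), never coverage. Every published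
theorem enters as one of the tree's named Literature facts BY NAME; nothing about any particular
curve is asserted; no label changes; X2c stays CONSTRUCTION-SHAPED until referee A rules.

## What this file records

`X2/ClassClosureO9Certificate.lean` (this seat, GEN 1) reduced the non-split gvpar sub-cell
`X2.CellCNonsplitGV` (and, given Mazur's MC at the pair, all of X2c ∧ ¬split) to ONE per-pair
input of instrument shape, `hc1 : [T¹]L ≠ 0` for THE non-split Mazur–Tate–Teitelbaum function of a
newform of `W` (Disegni 2020 Thm. 1, A183 `hD`). The tree now proves the finite-precision step
(`Literature/…/PAdicLFunctionNonsplitRiemannSumCertificateProofs.lean`, this seat GEN 7): THE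
function is the Mellin transform of the signed measure `μₙ(a) = (−1)ⁿ[a/pⁿ]⁺_f`
(`exists_isMultPAdicLFunctionOf_neg_one_of_nonsplit` + `IsMultPAdicLFunctionOf.unique`), so a
uniform bound `‖[a/pᵐ]⁺_f‖_p ≤ C` and ONE level `n` with `C·p⁻ⁿ < ‖RS 1 n‖` — `RS 1 n` the exact
finite Riemann sum `∑_ξ ∑_{s mod pⁿ} (−1)^{n+1}[ξγˢ/p^{n+1}]⁺_f · s` — give `[T¹]L ≠ 0` for EVERY
`L` of the package (`IsMultPAdicLFunctionOf.coeff_ne_zero_of_nonsplit_of_lt`). This file composes: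

* `X2.schneider_of_coeff_one_ne_zero_of_thm1_of_datum` — the GEN-1 node with a FIXED modular
  parametrisation datum `Dm` (newform `Dm.f`, period ratio from
  `Dm.exists_rat_mul_realPeriodRat_eq_plusPeriod`) in place of `hpar`, so that the certificate can
  speak about the plus symbols of a NAMED newform;
* `X2.schneider_of_nonsplit_riemannSum_certificate_of_thm1` — `(C, n)` for `Dm.f` ⟹ Schneider
  for every §4.2 height datum at the pair;
* `X2.bsdp_of_cellC_of_not_split_of_gvPar_of_thm1_of_riemannSum_certificate` —
  `X2.CellCNonsplitGV` ∧ `(C, n)` ⟹ `BSD(E,p)` from the published named facts of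
  `Partition/CornersMultSchneiderCellC.lean` (GV00-mult `hGV` — flag `GV00-mult-asserted` —,
  Wuthrich Thm. 16 `hWu`, SW Thm. 6.1 `hJn` + §4.2 existence `hHn`, Disegni A183 `hD`, GZK,
  modularity `hpar`), NO Schneider binder and NO coefficient binder;
* `X2.bsdp_of_cellC_of_not_split_of_mazurMainConjectureAt_of_thm1_of_riemannSum_certificate` —
  the same on X2c ∧ ¬split given Mazur's MC at the pair.

What an O9 instrument row would supply is EVIDENCE for `hC` (the member's plus-symbol denominators
at `p`-power arguments, all levels — Manin–Drinfeld, `exists_norm_ratPlusSymbol_le`, inexplicit in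
general) and `hlt` (one exact Riemann sum), in the engine's own normalisation (`x⁺_E = u_E·[·]⁺_f`;
`(hC, hlt)` scale together). No such O9 engine row exists at the time of writing (the lane's
X11-REPORT engine covers X11b); this is the TARGET SHAPE for one. Nothing booked; no count moves.

References: [Disegni2020] Thm. 1 (§1.2); [MazurTateTeitelbaum1986Invent] §I.10 Prop. (ε(p) = 0),
§I.11–I.14; [SteinWuthrich2013] §3, §4.2, Thm. 6.1; [GreenbergVatsal2000] Thm. (1.3);
[Wuthrich2014] Thm. 16.
-/

set_option autoImplicit false

noncomputable section

open scoped Classical MatrixGroups ModularForm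

open CongruenceSubgroup WeierstrassCurve Literature.NumberTheory.EllipticCurves
  Literature.NumberTheory.EllipticCurves.ModularForms
  Literature.NumberTheory.EllipticCurves.Rank1Residual
  Literature.NumberTheory.EllipticCurves.Rank1Residual.Typed
  Literature.NumberTheory.EllipticCurves.GreenbergVatsal2000
  Literature.NumberTheory.EllipticCurves.Wuthrich2014
  Literature.NumberTheory.EllipticCurves.SteinWuthrich2013
  Literature.NumberTheory.EllipticCurves.Disegni2020

namespace Summit.BirchSwinnertonDyer.Rank1Residual.X2

variable (W : WeierstrassCurve ℚ) [W.IsElliptic] [W.IsGloballyMinimal] (p : ℕ) [Fact p.Prime]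

/-- **`[T¹]L_p ≠ 0` ⟹ Schneider, FIXED DATUM form** of `schneider_of_coeff_one_ne_zero_of_thm1`: at
a non-split multiplicative `p ≠ 2` in analytic rank one, given a modular parametrisation datum `Dm`
of `W` (newform `Dm.f`), if every `L` of the non-split package for `Dm.f` has `[T¹]L ≠ 0` then every
§4.2 height datum at the pair is non-degenerate (Disegni's non-split identity A183 at `Dm.f` and the
positive period ratio of `Dm`). [cite: Disegni2020, Thm. 1 (§1.2) = Thm. 4 first bullet (§3.2)]
[cite: MazurTateTeitelbaum1986Invent, §I.13] [cite: SteinWuthrich2013, §4.2] -/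
theorem schneider_of_coeff_one_ne_zero_of_thm1_of_datum (hD : thm1_padicBSD_rankOne_multiplicative)
    {N : ℕ} [NeZero N] (Dm : ModularParametrizationData W N) (hp2 : p ≠ 2)
    (hmult : W.HasMultiplicativeReductionAtPrime p) (hns : ¬ W.HasSplitMultiplicativeReductionAtPrime p)
    (hr1 : W.analyticRank = 1)
    (hc1 : ∀ (L : PowerSeries ℚ_[p]), IsMultPAdicLFunctionOf Dm.f p (-1) L →
      PowerSeries.coeff 1 L ≠ 0)
    {q : ℚ_[p]} (hq0 : q ≠ 0) (hq1 : ‖q‖ < 1) (hqj : tateJ q = (W.j : ℚ_[p]))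
    (Dh : PAdicHeightData W p) (hDh : IsMultCanonical Dh q) : SchneiderConjecture Dh := by
  obtain ⟨ϖ, hϖpos, hϖ, -⟩ := Dm.exists_rat_mul_realPeriodRat_eq_plusPeriod
  obtain ⟨L, hL⟩ := exists_isMultPAdicLFunctionOf_neg_one_of_nonsplit Dm.isNewformOf hmult hns
  obtain ⟨s, u, -, hid⟩ := thm1_padicBSD_rankOne_multiplicative.nonsplit hD W p hp2 hmult hr1
    Dm.isNewformOf ϖ hϖpos.ne' hϖ hns hq0 hq1 hqj L hL Dh hDh
  have h1 : PowerSeries.coeff 1 L ≠ 0 := hc1 L hL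
  have hϖ0 : ((ϖ : ℚ) : ℚ_[p]) ≠ 0 := by exact_mod_cast hϖpos.ne'
  have hlog : padicLog p (cyclotomicGenerator p : ℚ_[p]) ≠ 0 :=
    Literature.Barriers.BirchSwinnertonDyer.padicLog_cyclotomicGenerator_ne_zero p
  have hT : (W.torsionOrder : ℚ_[p]) ^ 2 ≠ 0 :=
    pow_ne_zero 2 (by exact_mod_cast (W.torsionOrder_pos_holds).ne')
  change padicRegulator Dh ≠ 0
  intro hReg
  have hz : ((ϖ : ℚ) : ℚ_[p]) * PowerSeries.coeff 1 L * padicLog p (cyclotomicGenerator p) *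
      (W.torsionOrder : ℚ_[p]) ^ 2 = 0 := by
    rw [hid, hReg]; ring
  exact mul_ne_zero (mul_ne_zero (mul_ne_zero hϖ0 h1) hlog) hT hz

section RiemannSum

variable {N : ℕ} [NeZero N] (Dm : ModularParametrizationData W N) {RS : ℕ → ℕ → ℚ_[p]}
  (hRS : ∀ k n : ℕ, RS k n =
      ∑ᶠ ξ : rootsOfUnity (torsionOrder p) ℤ_[p], ∑ s : ZMod (p ^ n),
        (fun (n : ℕ) (a : ZMod (p ^ n)) ↦
            (-1 : ℚ_[p]) ^ n * (ratPlusSymbol Dm.f ((a.val : ℚ) / (p : ℚ) ^ n) : ℚ_[p]))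
          (n + cyclotomicExponent p)
            (PadicInt.toZModPow (n + cyclotomicExponent p) ((ξ : ℤ_[p]ˣ) : ℤ_[p]) *
              (cyclotomicGenerator p : ZMod (p ^ (n + cyclotomicExponent p))) ^ s.val) *
          ((s.val.choose k : ℕ) : ℚ_[p]))

include hRS

/-- **O9 non-split: Riemann-sum certificate ⟹ Schneider.** At a non-split multiplicative `p ≠ 2`
in analytic rank one, with a modular parametrisation datum `Dm`: a bound `‖[a/pᵐ]⁺_{Dm.f}‖_p ≤ C`
at every level and ONE level `n` with `C·p⁻ⁿ < ‖RS 1 n‖` (the Riemann sums `RS` of the signed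
measure, `hRS`) give `[T¹]L ≠ 0` for THE non-split function
(`IsMultPAdicLFunctionOf.coeff_ne_zero_of_nonsplit_of_lt`), hence Schneider for every §4.2 datum
(`schneider_of_coeff_one_ne_zero_of_thm1_of_datum`). [cite: SteinWuthrich2013, §3 and §4.2]
[cite: Disegni2020, Thm. 1 (§1.2)] -/
theorem schneider_of_nonsplit_riemannSum_certificate_of_thm1
    (hD : thm1_padicBSD_rankOne_multiplicative) (hp2 : p ≠ 2)
    (hmult : W.HasMultiplicativeReductionAtPrime p) (hns : ¬ W.HasSplitMultiplicativeReductionAtPrime p)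
    (hr1 : W.analyticRank = 1) {C : ℝ}
    (hC : ∀ (m : ℕ) (a : ZMod (p ^ m)),
      ‖(ratPlusSymbol Dm.f ((a.val : ℚ) / (p : ℚ) ^ m) : ℚ_[p])‖ ≤ C)
    {n : ℕ} (hlt : C * (p : ℝ) ^ (-n : ℤ) < ‖RS 1 n‖)
    {q : ℚ_[p]} (hq0 : q ≠ 0) (hq1 : ‖q‖ < 1) (hqj : tateJ q = (W.j : ℚ_[p]))
    (Dh : PAdicHeightData W p) (hDh : IsMultCanonical Dh q) : SchneiderConjecture Dh :=
  schneider_of_coeff_one_ne_zero_of_thm1_of_datum W p hD Dm hp2 hmult hns hr1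
    (fun _ hL ↦ hL.coeff_ne_zero_of_nonsplit_of_lt hRS Dm.isNewformOf hmult hns hC (k := 1) (n := n)
      (by rwa [Nat.factorial_one, Nat.cast_one, norm_one, div_one]))
    hq0 hq1 hqj Dh hDh

/-- **Sub-cell `X2.CellCNonsplitGV` ∧ Riemann-sum certificate ⟹ `BSD(E,p)`** —
`bsdp_of_cellC_of_not_split_of_gvPar_of_thm1_of_schneider` (p251198) with its per-pair Schneider
binder supplied by `schneider_of_nonsplit_riemannSum_certificate_of_thm1`. PUBLISHED named facts
(A183 `hD`; GV00 at `p ‖ N` `hGV`, flag `GV00-mult-asserted`; Wuthrich Thm. 16 `hWu`; SW Thm. 6.1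
`hJn`, §4.2 existence `hHn`; GZK; modularity `hpar`) + a modular parametrisation datum `Dm` + the
numerical pair `(hC, hlt)`. CONDITIONAL; nothing booked; X2c stays CONSTRUCTION-SHAPED.
[cite: Disegni2020, Thm. 1 (§1.2)] [cite: GreenbergVatsal2000, Thm. (1.3) with pp. 1, 14–15]
[cite: Wuthrich2014, Thm. 16 (p. 397)] [cite: SteinWuthrich2013, Thm. 6.1 (p. 20), §3, §4.2] -/
theorem bsdp_of_cellC_of_not_split_of_gvPar_of_thm1_of_riemannSum_certificate
    (hD : thm1_padicBSD_rankOne_multiplicative) (hGV : lambdaMu_multiplicative_of_gvPar)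
    (hWu : thm16_charIdeal_dvd_multiplicative_of_reducible) (hJn : thm61_nonsplitMultiplicative)
    (hHn : exists_isMultCanonical) (hGZK : rank_eq_analyticRank_of_analyticRank_le_one)
    (hpar : nonempty_modularParametrizationData) (hc : CellCNonsplitGV W p) {C : ℝ}
    (hC : ∀ (m : ℕ) (a : ZMod (p ^ m)),
      ‖(ratPlusSymbol Dm.f ((a.val : ℚ) / (p : ℚ) ^ m) : ℚ_[p])‖ ≤ C)
    {n : ℕ} (hlt : C * (p : ℝ) ^ (-n : ℤ) < ‖RS 1 n‖) : BSDp W p :=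
  bsdp_of_cellC_of_not_split_of_gvPar_of_thm1_of_schneider W p hD hGV hWu hJn hHn hGZK hpar hc
    (fun _ Dh hq0 hq1 hqj hDh ↦ schneider_of_nonsplit_riemannSum_certificate_of_thm1 W p Dm hRS hD
      hc.1.2.1 hc.1.2.2.2 hc.2.1 hc.1.1 hC hlt hq0 hq1 hqj Dh hDh)

/-- **X2c ∧ ¬split ∧ Mazur's MC at the pair ∧ Riemann-sum certificate ⟹ `BSD(E,p)`** — the whole
non-split half of O9 with the numerical pair `(hC, hlt)` in place of the Schneider binder.
CONDITIONAL; nothing booked. [cite: Disegni2020, Thm. 1 (§1.2)]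
[cite: SteinWuthrich2013, Thm. 6.1 (p. 20), §3, §4.2] -/
theorem bsdp_of_cellC_of_not_split_of_mazurMainConjectureAt_of_thm1_of_riemannSum_certificate
    (hD : thm1_padicBSD_rankOne_multiplicative) (hJn : thm61_nonsplitMultiplicative)
    (hHn : exists_isMultCanonical) (hGZK : rank_eq_analyticRank_of_analyticRank_le_one)
    (hpar : nonempty_modularParametrizationData)
    (hc : CellC W p) (hns : ¬ W.HasSplitMultiplicativeReductionAtPrime p)
    (hMC : MazurMainConjectureAt W p) {C : ℝ}
    (hC : ∀ (m : ℕ) (a : ZMod (p ^ m)),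
      ‖(ratPlusSymbol Dm.f ((a.val : ℚ) / (p : ℚ) ^ m) : ℚ_[p])‖ ≤ C)
    {n : ℕ} (hlt : C * (p : ℝ) ^ (-n : ℤ) < ‖RS 1 n‖) : BSDp W p :=
  bsdp_of_cellC_of_not_split_of_mazurMainConjectureAt_of_thm1_of_schneider W p hD hJn hHn hGZK hpar
    hc hns hMC
    (fun _ Dh hq0 hq1 hqj hDh ↦ schneider_of_nonsplit_riemannSum_certificate_of_thm1 W p Dm hRS hD
      hc.2.1 hc.2.2.2 hns hc.1 hC hlt hq0 hq1 hqj Dh hDh)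

end RiemannSum

end Summit.BirchSwinnertonDyer.Rank1Residual.X2

end
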